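import Literature.Analysis.FunctionSpaces.TorusSymL2
import Mathlib.Analysis.Normed.Operator.BanachSteinhaus
import Mathlib.Analysis.InnerProductSpace.Adjoint
import HarnessLib

/-!
# Weak convergence in the real Hilbert space `SymL2 d`: coordinates, boundedness, and compact
# diagonal multipliers (Rellich's lemma in Fourier variables)

Analysis/FunctionSpaces support file, sequel of `TorusSymL2.lean` (the real Hilbert space of
conjugation-symmetric square-summable coefficient families on `ℤ^d`, carrier of all Sobolev
spaces `H^s(T^d; ℝ^d)` for the energy-method construction of Euler flows in the periodic
cylinder, `Literature.Analysis.FluidPDE.KatoLai1984_periodicCylinderUniformExistence`). The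
abstract existence theorem (Kato–Lai 1984, Thm A; tree `KatoLai.thmA_form`) asks for sequential
weak continuity of the nonlinear operator; in Fourier variables weak convergence is elementary:

* `SymL2.WeakTendsto f g` — `⟪h, f n⟫ → ⟪h, g⟫` for every `h` (the form used by
  `KatoLai.IsSeqWeaklyContinuousFormOn`);
* `WeakTendsto.tendsto_apply` — **weakly convergent sequences converge coordinatewise** (test
  against the symmetric two-mode families `symSingle k a`);
* `WeakTendsto.exists_norm_le` — **weakly convergent sequences are bounded** (Banach–Steinhaus);
* `weakTendsto_of_bounded_of_tendsto_apply` — conversely, **bounded and coordinatewise convergent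
  sequences converge weakly** (truncate the test element);
* `WeakTendsto.tendsto_diag_of_vanishing` — **compact multipliers**: if the (bounded, even)
  symbol `m` tends to `0` at infinity, `diag m` maps weakly convergent sequences to norm
  convergent ones — with `m(k) = ⟨k⟩^{s'-s}`, `s' < s`, this is Rellich's lemma `H^s ⋐ H^{s'}`
  on the torus (F. W. Warner, GTM 94, Lemma 6.23; the tree's `Lattice.rellich` is the
  subsequence form for non-symmetric families);
* `WeakTendsto.map_clm`, `WeakTendsto.of_tendsto` — continuous linear maps preserve weak
  convergence (adjoint), norm convergence implies weak convergence.

Everything is proved; no named fact and no `sorry` is introduced.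

## Mathlib / tree search

Mathlib: `banach_steinhaus`, `innerSL`, `innerSL_apply_norm`, `ContinuousLinearMap.adjoint`,
`ContinuousLinearMap.adjoint_inner_left`, `isBounded_range_of_tendsto`, `hasSum_le`,
`tsum_eq_sum`, `EuclideanSpace.inner_single_left`. Tree: `SymL2`, `SymL2.trunc`,
`SymL2.tendsto_trunc`, `SymL2.ofFinSupp`, `SymL2.hasSum_inner`, `SymL2.hasSum_norm_sq_diag`
(`TorusSymL2`); `Lattice.rellich` (`LatticeSobolevRellich`, subsequence form, not used).

## References

* T. Kato, C. Y. Lai, J. Funct. Anal. 56 (1984) 15–28, §3, Thm A (weak continuity). [KatoLai1984]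
* F. W. Warner, *Foundations of Differentiable Manifolds and Lie Groups*, GTM 94, Lemma 6.23
  (Rellich). [WarnerGTM94]
-/

noncomputable section

open Filter Topology TopologicalSpace Finset
open scoped ENNReal NNReal ComplexConjugate InnerProductSpace

namespace Literature.Analysis.FunctionSpaces

namespace Torus

namespace SymL2

universe u

variable {d : Type u} [Fintype d]

/-! ### Weak convergence -/

/-- **Weak convergence** of a sequence in the real Hilbert space `SymL2 d`:
`⟪h, f n⟫ → ⟪h, g⟫` for every `h`. [cite: KatoLai1984, §3 Thm A] -/
def WeakTendsto (f : ℕ → SymL2 d) (g : SymL2 d) : Prop :=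
  ∀ h : SymL2 d, Tendsto (fun n => ⟪h, f n⟫_ℝ) atTop (𝓝 ⟪h, g⟫_ℝ)

/-- Norm convergence implies weak convergence. [folklore] -/
theorem WeakTendsto.of_tendsto {f : ℕ → SymL2 d} {g : SymL2 d} (h : Tendsto f atTop (𝓝 g)) : WeakTendsto f g :=
  fun k => ((innerSL ℝ k).continuous.tendsto g).comp h

/-- **Continuous linear maps preserve weak convergence** (`⟪h, T f⟫ = ⟪T† h, f⟫`). [folklore] -/
theorem WeakTendsto.map_clm {f : ℕ → SymL2 d} {g : SymL2 d} (hf : WeakTendsto f g) (T : SymL2 d →L[ℝ] SymL2 d) :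
    WeakTendsto (fun n => T (f n)) (T g) := by
  intro h
  have e : ∀ x : SymL2 d, ⟪h, T x⟫_ℝ = ⟪ContinuousLinearMap.adjoint T h, x⟫_ℝ := fun x =>
    (ContinuousLinearMap.adjoint_inner_left T x h).symm
  simp only [e]
  exact hf _

/-- Weak limits of differences. [folklore] -/
theorem WeakTendsto.sub_const {f : ℕ → SymL2 d} {g : SymL2 d} (hf : WeakTendsto f g) :
    WeakTendsto (fun n => f n - g) 0 := by
  intro h
  have : Tendsto (fun n => ⟪h, f n⟫_ℝ - ⟪h, g⟫_ℝ) atTop (𝓝 (⟪h, g⟫_ℝ - ⟪h, g⟫_ℝ)) := (hf h).sub tendsto_const_nhds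
  rw [sub_self] at this
  simpa [inner_sub_right, inner_zero_right] using this

/-! ### The symmetric two-mode test families -/

section TestFamilies

/-- The symmetric two-mode family with `a` at `k` and `conj a` at `-k` (summed if `k = -k`).
[folklore] -/
def symSingleFun (k : d → ℤ) (a : EuclideanSpace ℂ d) (l : d → ℤ) : EuclideanSpace ℂ d :=
  (if l = k then a else 0) + (if l = -k then EuclideanSpace.conjVec a else 0)

/-- The two-mode family is conjugation symmetric. [folklore] -/
theorem isConjSymm_symSingleFun (k : d → ℤ) (a : EuclideanSpace ℂ d) : IsConjSymm (symSingleFun k a) := by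
  intro l
  simp only [symSingleFun, EuclideanSpace.conjVec_add, apply_ite EuclideanSpace.conjVec,
    EuclideanSpace.conjVec_conjVec, EuclideanSpace.conjVec_zero, neg_eq_iff_eq_neg, neg_neg]
  rw [add_comm]

/-- The two-mode family is supported in `{k, -k}`. [folklore] -/
theorem symSingleFun_eq_zero (k : d → ℤ) (a : EuclideanSpace ℂ d) {l : d → ℤ} (hl : l ∉ ({k, -k} : Finset (d → ℤ))) :
    symSingleFun k a l = 0 := by
  simp only [mem_insert, mem_singleton, not_or] at hl
  simp [symSingleFun, hl.1, hl.2]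

/-- **The symmetric two-mode test element** `symSingle k a ∈ SymL2 d`. [folklore] -/
def symSingle (k : d → ℤ) (a : EuclideanSpace ℂ d) : SymL2 d :=
  ofFinSupp (symSingleFun k a) {k, -k} (fun _ hl => symSingleFun_eq_zero k a hl) (isConjSymm_symSingleFun k a)

/-- **Pairing with the test element**: `⟪symSingle k a, f⟫ = Re ⟪a, f k⟫ + Re ⟪conj a, f (-k)⟫`.
[folklore] -/
theorem inner_symSingle_left (k : d → ℤ) (a : EuclideanSpace ℂ d) (f : SymL2 d) :
    ⟪symSingle k a, f⟫_ℝ = RCLike.re ⟪a, f k⟫_ℂ + RCLike.re ⟪EuclideanSpace.conjVec a, f (-k)⟫_ℂ := by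
  have h := hasSum_inner (symSingle k a) f
  have hA : HasSum (fun l => RCLike.re ⟪(if l = k then a else 0 : EuclideanSpace ℂ d), f l⟫_ℂ) (RCLike.re ⟪a, f k⟫_ℂ) := by
    convert hasSum_ite_eq k (RCLike.re ⟪a, f k⟫_ℂ) using 1
    funext l
    split_ifs with hl
    · subst hl; rfl
    · simp
  have hB : HasSum (fun l => RCLike.re ⟪(if l = -k then EuclideanSpace.conjVec a else 0 : EuclideanSpace ℂ d), f l⟫_ℂ)
      (RCLike.re ⟪EuclideanSpace.conjVec a, f (-k)⟫_ℂ) := by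
    convert hasSum_ite_eq (-k) (RCLike.re ⟪EuclideanSpace.conjVec a, f (-k)⟫_ℂ) using 1
    funext l
    split_ifs with hl
    · subst hl; rfl
    · simp
  refine h.unique ?_
  convert hA.add hB using 1
  funext l
  rw [symSingle, ofFinSupp_apply, symSingleFun, inner_add_left, map_add]

/-- The pairing determines `Re ⟪a, f k⟫`: `⟪symSingle k a, f⟫ = 2 Re ⟪a, f k⟫`. [folklore] -/
theorem inner_symSingle_left_eq (k : d → ℤ) (a : EuclideanSpace ℂ d) (f : SymL2 d) :
    ⟪symSingle k a, f⟫_ℝ = 2 * RCLike.re ⟪a, f k⟫_ℂ := by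
  rw [inner_symSingle_left, f.apply_neg, two_mul]
  congr 1
  -- `⟪conj a, conj b⟫ = conj ⟪a, b⟫`
  have : ⟪EuclideanSpace.conjVec a, EuclideanSpace.conjVec (f k)⟫_ℂ = conj ⟪a, f k⟫_ℂ := by
    simp [PiLp.inner_apply, EuclideanSpace.conjVec_apply, mul_comm]
  rw [this, RCLike.conj_re]

end TestFamilies

/-! ### Coordinates of weak limits -/

/-- The real parts of the pairings of the coordinates with a fixed vector converge. [folklore] -/
theorem WeakTendsto.tendsto_re_inner_apply {f : ℕ → SymL2 d} {g : SymL2 d} (hf : WeakTendsto f g)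
    (k : d → ℤ) (a : EuclideanSpace ℂ d) :
    Tendsto (fun n => RCLike.re ⟪a, f n k⟫_ℂ) atTop (𝓝 (RCLike.re ⟪a, g k⟫_ℂ)) := by
  have h := hf (symSingle k a)
  simp only [inner_symSingle_left_eq] at h
  have h2 := h.const_mul (1 / 2 : ℝ)
  simp only [one_div, ne_eq, OfNat.ofNat_ne_zero, not_false_eq_true, inv_mul_cancel_left₀] at h2
  exact h2

/-- The components of the coordinates converge. [folklore] -/
theorem WeakTendsto.tendsto_apply_coord [DecidableEq d] {f : ℕ → SymL2 d} {g : SymL2 d} (hf : WeakTendsto f g)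
    (k : d → ℤ) (i : d) : Tendsto (fun n => f n k i) atTop (𝓝 (g k i)) := by
  have hre := hf.tendsto_re_inner_apply k (EuclideanSpace.single i (1 : ℂ))
  have him := hf.tendsto_re_inner_apply k (EuclideanSpace.single i Complex.I)
  have e1 : ∀ v : EuclideanSpace ℂ d, RCLike.re ⟪EuclideanSpace.single i (1 : ℂ), v⟫_ℂ = (v i).re := fun v => by
    rw [EuclideanSpace.inner_single_left, map_one, one_mul]; rfl
  have e2 : ∀ v : EuclideanSpace ℂ d, RCLike.re ⟪EuclideanSpace.single i Complex.I, v⟫_ℂ = (v i).im := fun v => by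
    rw [EuclideanSpace.inner_single_left, Complex.conj_I]
    simp
  simp only [e1] at hre
  simp only [e2] at him
  have h := ((Complex.continuous_ofReal.tendsto _).comp hre).add
    (((Complex.continuous_ofReal.tendsto _).comp him).mul (tendsto_const_nhds (x := Complex.I)))
  simpa [Function.comp_def, Complex.re_add_im] using h

/-- **Weakly convergent sequences converge coordinatewise.** [folklore] -/
theorem WeakTendsto.tendsto_apply {f : ℕ → SymL2 d} {g : SymL2 d} (hf : WeakTendsto f g) (k : d → ℤ) :
    Tendsto (fun n => f n k) atTop (𝓝 (g k)) := by
  classical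
  have hpi : Tendsto (fun n => WithLp.ofLp (f n k)) atTop (𝓝 (WithLp.ofLp (g k))) :=
    tendsto_pi_nhds.2 fun i => hf.tendsto_apply_coord k i
  have h : Tendsto (fun n => WithLp.toLp 2 (WithLp.ofLp (f n k))) atTop (𝓝 (WithLp.toLp 2 (WithLp.ofLp (g k)))) :=
    ((PiLp.continuous_toLp 2 (fun _ : d => ℂ)).tendsto _).comp hpi
  simpa only [WithLp.toLp_ofLp] using h

/-! ### Boundedness of weakly convergent sequences -/

/-- **Weakly convergent sequences are bounded** (uniform boundedness principle applied to the
functionals `⟪f n, ·⟫`). [folklore] -/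
theorem WeakTendsto.exists_norm_le {f : ℕ → SymL2 d} {g : SymL2 d} (hf : WeakTendsto f g) :
    ∃ R : ℝ, 0 ≤ R ∧ ∀ n, ‖f n‖ ≤ R := by
  have hpt : ∀ h : SymL2 d, ∃ C, ∀ n, ‖(innerSL ℝ (f n)) h‖ ≤ C := by
    intro h
    have ht : Tendsto (fun n => ⟪f n, h⟫_ℝ) atTop (𝓝 ⟪g, h⟫_ℝ) := by
      simpa only [real_inner_comm] using hf h
    obtain ⟨C, hC⟩ := (Metric.isBounded_range_of_tendsto _ ht).exists_norm_le
    exact ⟨C, fun n => by simpa using hC _ (Set.mem_range_self n)⟩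
  obtain ⟨C, hC⟩ := banach_steinhaus hpt
  refine ⟨max C 0, le_max_right _ _, fun n => ?_⟩
  rw [← innerSL_apply_norm ℝ (f n)]
  exact (hC n).trans (le_max_left _ _)

/-! ### Bounded coordinatewise convergent sequences converge weakly -/

section Converse

variable [DecidableEq d]

/-- The pairing with a truncated element is a finite sum. [folklore] -/
theorem inner_trunc_left (N : ℕ) (h f : SymL2 d) :
    ⟪trunc N h, f⟫_ℝ = ∑ k ∈ freqBall N, RCLike.re ⟪h k, f k⟫_ℂ := by
  refine (hasSum_inner (trunc N h) f).unique ?_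
  have hz : ∀ k ∉ freqBall N, RCLike.re ⟪trunc N h k, f k⟫_ℂ = 0 := fun k hk => by
    simp [trunc_apply_of_not_mem N h hk]
  have hs : HasSum (fun k => RCLike.re ⟪trunc N h k, f k⟫_ℂ) (∑ k ∈ freqBall N, RCLike.re ⟪trunc N h k, f k⟫_ℂ) :=
    hasSum_sum_of_ne_finset_zero hz
  have heq : ∑ k ∈ freqBall N, RCLike.re ⟪trunc N h k, f k⟫_ℂ = ∑ k ∈ freqBall N, RCLike.re ⟪h k, f k⟫_ℂ :=
    sum_congr rfl fun k hk => by rw [trunc_apply_of_mem N h hk]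
  rwa [heq] at hs

/-- **Bounded coordinatewise convergent sequences converge weakly.** [folklore] -/
theorem weakTendsto_of_bounded_of_tendsto_apply {f : ℕ → SymL2 d} {g : SymL2 d} {R : ℝ}
    (hR : ∀ n, ‖f n‖ ≤ R) (hc : ∀ k, Tendsto (fun n => f n k) atTop (𝓝 (g k))) : WeakTendsto f g := by
  intro h
  rw [Metric.tendsto_atTop]
  intro ε hε
  have hRg : 0 ≤ R + ‖g‖ := by
    have := (norm_nonneg _).trans (hR 0)
    positivity
  -- truncate the test element
  obtain ⟨N, hN⟩ : ∃ N, ‖h - trunc N h‖ * (R + ‖g‖) < ε / 2 := by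
    have ht : Tendsto (fun N => ‖h - trunc N h‖ * (R + ‖g‖)) atTop (𝓝 (0 * (R + ‖g‖))) := by
      refine Tendsto.mul_const _ ?_
      have := (tendsto_trunc h)
      rw [tendsto_iff_norm_sub_tendsto_zero] at this
      simpa [norm_sub_rev] using this
    rw [zero_mul] at ht
    exact (ht.eventually (gt_mem_nhds (by positivity))).exists
  -- the finitely many retained coordinates converge
  have hfin : Tendsto (fun n => ∑ k ∈ freqBall N, RCLike.re ⟪h k, f n k⟫_ℂ) atTop
      (𝓝 (∑ k ∈ freqBall N, RCLike.re ⟪h k, g k⟫_ℂ)) := by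
    refine tendsto_finsetSum _ fun k _ => ?_
    exact (Complex.continuous_re.tendsto _).comp (((innerSL ℂ (h k)).continuous.tendsto _).comp (hc k))
  rw [Metric.tendsto_atTop] at hfin
  obtain ⟨n₀, hn₀⟩ := hfin (ε / 2) (by positivity)
  refine ⟨n₀, fun n hn => ?_⟩
  have hsplit : ∀ x : SymL2 d, ⟪h, x⟫_ℝ = ⟪trunc N h, x⟫_ℝ + ⟪h - trunc N h, x⟫_ℝ := fun x => by
    rw [← inner_add_left, add_sub_cancel]
  rw [Real.dist_eq, hsplit (f n), hsplit g, inner_trunc_left, inner_trunc_left]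
  have htail : |⟪h - trunc N h, f n⟫_ℝ - ⟪h - trunc N h, g⟫_ℝ| ≤ ‖h - trunc N h‖ * (R + ‖g‖) := by
    rw [← inner_sub_right]
    refine (abs_real_inner_le_norm _ _).trans (mul_le_mul_of_nonneg_left ?_ (norm_nonneg _))
    exact (norm_sub_le _ _).trans (add_le_add (hR n) le_rfl)
  have h1 := hn₀ n hn
  rw [Real.dist_eq] at h1
  calc |∑ k ∈ freqBall N, RCLike.re ⟪h k, f n k⟫_ℂ + ⟪h - trunc N h, f n⟫_ℝ -
        (∑ k ∈ freqBall N, RCLike.re ⟪h k, g k⟫_ℂ + ⟪h - trunc N h, g⟫_ℝ)|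
      = |(∑ k ∈ freqBall N, RCLike.re ⟪h k, f n k⟫_ℂ - ∑ k ∈ freqBall N, RCLike.re ⟪h k, g k⟫_ℂ) +
          (⟪h - trunc N h, f n⟫_ℝ - ⟪h - trunc N h, g⟫_ℝ)| := by ring_nf
    _ ≤ |∑ k ∈ freqBall N, RCLike.re ⟪h k, f n k⟫_ℂ - ∑ k ∈ freqBall N, RCLike.re ⟪h k, g k⟫_ℂ| +
          |⟪h - trunc N h, f n⟫_ℝ - ⟪h - trunc N h, g⟫_ℝ| := abs_add_le _ _
    _ < ε / 2 + ε / 2 := add_lt_add_of_lt_of_le h1 (htail.trans hN.le)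
    _ = ε := by ring

end Converse

/-- **Weak convergence is boundedness plus coordinatewise convergence.** [folklore] -/
theorem weakTendsto_iff [DecidableEq d] {f : ℕ → SymL2 d} {g : SymL2 d} :
    WeakTendsto f g ↔ (∃ R : ℝ, ∀ n, ‖f n‖ ≤ R) ∧ ∀ k, Tendsto (fun n => f n k) atTop (𝓝 (g k)) := by
  constructor
  · intro hf
    obtain ⟨R, -, hR⟩ := hf.exists_norm_le
    exact ⟨⟨R, hR⟩, hf.tendsto_apply⟩
  · rintro ⟨⟨R, hR⟩, hc⟩
    exact weakTendsto_of_bounded_of_tendsto_apply hR hc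

/-! ### Compact diagonal multipliers (Rellich) -/

/-- A symbol **vanishing at infinity**: off larger and larger frequency balls it is uniformly
small. [folklore] -/
def VanishingSymbol [DecidableEq d] (m : (d → ℤ) → ℝ) : Prop :=
  ∀ ε > 0, ∃ N : ℕ, ∀ k ∉ freqBall N, |m k| ≤ ε

/-- **Compact multipliers map weakly convergent sequences to norm convergent ones** (Rellich's
lemma in Fourier variables: with `m(k) = ⟨k⟩^{s'-s}`, `s' < s`, the inclusion `H^s ⊂ H^{s'}`).
[cite: WarnerGTM94, Lemma 6.23] -/
theorem WeakTendsto.tendsto_diag_of_vanishing [DecidableEq d] {f : ℕ → SymL2 d} {g : SymL2 d} (hf : WeakTendsto f g)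
    {m : (d → ℤ) → ℝ} {M : ℝ} (hm : ∀ k, |m k| ≤ M) (heven : ∀ k, m (-k) = m k) (hvan : VanishingSymbol m) :
    Tendsto (fun n => diag m hm heven (f n)) atTop (𝓝 (diag m hm heven g)) := by
  obtain ⟨R, hR0, hR⟩ := hf.exists_norm_le
  have hM0 : 0 ≤ M := (abs_nonneg _).trans (hm 0)
  set e : ℕ → SymL2 d := fun n => f n - g with he
  have heb : ∀ n, ‖e n‖ ≤ R + ‖g‖ := fun n => (norm_sub_le _ _).trans (add_le_add (hR n) le_rfl)
  have hec : ∀ k, Tendsto (fun n => e n k) atTop (𝓝 0) := fun k => by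
    have := (hf.tendsto_apply k).sub (tendsto_const_nhds (x := g k))
    rw [sub_self] at this
    simpa [he] using this
  -- it suffices to show `‖diag m (e n)‖ → 0`
  rw [tendsto_iff_norm_sub_tendsto_zero]
  have hlin : ∀ n, diag m hm heven (f n) - diag m hm heven g = diag m hm heven (e n) := fun n => by
    simp [he, map_sub]
  simp only [hlin]
  rw [Metric.tendsto_atTop]
  intro ε hε
  -- choose the frequency ball off which `m` is small
  set B : ℝ := R + ‖g‖ + 1 with hB
  have hB0 : 0 < B := by rw [hB]; positivity
  obtain ⟨N, hN⟩ := hvan (ε / (2 * B)) (by positivity)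
  -- the retained coordinates tend to zero
  have hfin : Tendsto (fun n => ∑ k ∈ freqBall N, M ^ 2 * ‖e n k‖ ^ 2) atTop (𝓝 0) := by
    have : Tendsto (fun n => ∑ k ∈ freqBall N, M ^ 2 * ‖e n k‖ ^ 2) atTop
        (𝓝 (∑ k ∈ freqBall N, M ^ 2 * ‖(0 : EuclideanSpace ℂ d)‖ ^ 2)) :=
      tendsto_finsetSum _ fun k _ => ((hec k).norm.pow 2).const_mul _
    simpa using this
  rw [Metric.tendsto_atTop] at hfin
  obtain ⟨n₀, hn₀⟩ := hfin ((ε / 2) ^ 2) (by positivity)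
  refine ⟨n₀, fun n hn => ?_⟩
  have h1 := hn₀ n hn
  rw [Real.dist_eq, sub_zero, abs_of_nonneg (sum_nonneg fun k _ => by positivity)] at h1
  -- pointwise comparison of the symbol
  have hpt : ∀ k, m k ^ 2 * ‖e n k‖ ^ 2 ≤
      (if k ∈ freqBall N then M ^ 2 * ‖e n k‖ ^ 2 else 0) + (ε / (2 * B)) ^ 2 * ‖e n k‖ ^ 2 := by
    intro k
    by_cases hk : k ∈ freqBall N
    · rw [if_pos hk]
      have : m k ^ 2 ≤ M ^ 2 := by rw [← sq_abs]; exact pow_le_pow_left₀ (abs_nonneg _) (hm k) 2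
      nlinarith [sq_nonneg ‖e n k‖, sq_nonneg (ε / (2 * B))]
    · rw [if_neg hk, zero_add]
      have : m k ^ 2 ≤ (ε / (2 * B)) ^ 2 := by rw [← sq_abs]; exact pow_le_pow_left₀ (abs_nonneg _) (hN k hk) 2
      exact mul_le_mul_of_nonneg_right this (sq_nonneg _)
  have hind : HasSum (fun k => if k ∈ freqBall N then M ^ 2 * ‖e n k‖ ^ 2 else 0)
      (∑ k ∈ freqBall N, M ^ 2 * ‖e n k‖ ^ 2) := by
    have hz : ∀ k ∉ freqBall N, (if k ∈ freqBall N then M ^ 2 * ‖e n k‖ ^ 2 else 0) = 0 := fun k hk => if_neg hk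
    have hs : HasSum (fun k => if k ∈ freqBall N then M ^ 2 * ‖e n k‖ ^ 2 else 0)
        (∑ k ∈ freqBall N, if k ∈ freqBall N then M ^ 2 * ‖e n k‖ ^ 2 else 0) := hasSum_sum_of_ne_finset_zero hz
    rwa [sum_congr rfl fun k hk => if_pos hk] at hs
  have hsum : ‖diag m hm heven (e n)‖ ^ 2 ≤
      (∑ k ∈ freqBall N, M ^ 2 * ‖e n k‖ ^ 2) + (ε / (2 * B)) ^ 2 * ‖e n‖ ^ 2 :=
    hasSum_le hpt (hasSum_norm_sq_diag m hm heven (e n)) (hind.add ((hasSum_norm_sq (e n)).mul_left _))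
  have h2 : (ε / (2 * B)) ^ 2 * ‖e n‖ ^ 2 ≤ (ε / 2) ^ 2 := by
    have heB : ‖e n‖ ≤ B := (heb n).trans (by rw [hB]; linarith)
    have h0 : 0 ≤ ‖e n‖ := norm_nonneg _
    have : (ε / (2 * B)) ^ 2 * ‖e n‖ ^ 2 = (ε / 2) ^ 2 * (‖e n‖ / B) ^ 2 := by
      field_simp
    rw [this]
    have hq : (‖e n‖ / B) ^ 2 ≤ 1 := by
      have : ‖e n‖ / B ≤ 1 := (div_le_one hB0).2 heB
      have h0' : 0 ≤ ‖e n‖ / B := by positivity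
      nlinarith
    nlinarith [sq_nonneg (ε / 2)]
  have hsq : ‖diag m hm heven (e n)‖ ^ 2 < ε ^ 2 := by
    calc ‖diag m hm heven (e n)‖ ^ 2 ≤ _ := hsum
      _ < (ε / 2) ^ 2 + (ε / 2) ^ 2 := add_lt_add_of_lt_of_le h1 h2
      _ ≤ ε ^ 2 := by nlinarith
  rw [dist_zero_right, norm_norm]
  exact (abs_lt_of_sq_lt_sq' hsq hε.le).2

/-- **Powers of the Japanese bracket with negative exponent vanish at infinity**: the symbol
`⟨k⟩^{-t} = (1 + |k|²)^{-t/2}`, `t > 0`, is a vanishing symbol. [folklore] -/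
theorem vanishingSymbol_sobolevWeight_neg [DecidableEq d] {t : ℝ} (ht : 0 < t) :
    VanishingSymbol (fun k : d → ℤ => sobolevWeight (-t) k) := by
  intro ε hε
  obtain ⟨N, hN⟩ := exists_nat_ge (Real.sqrt (ε ^ (-(2 / t))))
  refine ⟨N, fun k hk => ?_⟩
  rw [not_mem_freqBall] at hk
  have hpos : 0 < sobolevWeight (-t) k := sobolevWeight_pos _ _
  rw [abs_of_pos hpos, sobolevWeight]
  have h1 : ε ^ (-(2 / t)) ≤ 1 + freqNormSq k := by
    have hN' : Real.sqrt (ε ^ (-(2 / t))) ^ 2 ≤ (N : ℝ) ^ 2 :=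
      pow_le_pow_left₀ (Real.sqrt_nonneg _) hN 2
    rw [Real.sq_sqrt (Real.rpow_nonneg hε.le _)] at hN'
    linarith [freqNormSq_nonneg k]
  have h2 : (1 + freqNormSq k) ^ (-t / 2) ≤ (ε ^ (-(2 / t))) ^ (-t / 2) :=
    Real.rpow_le_rpow_of_nonpos (Real.rpow_pos_of_pos hε _) h1 (by linarith)
  refine h2.trans (le_of_eq ?_)
  rw [← Real.rpow_mul hε.le]
  have : -(2 / t) * (-t / 2) = 1 := by field_simp
  rw [this, Real.rpow_one]

end SymL2

end Torus

end Literature.Analysis.FunctionSpaces
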